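import Summits.Parity.GeneralizedHardyLittlewood.Theses.PolynomialKatai
import Summits.Parity.GeneralizedHardyLittlewood.Theses.LiouvilleOpening
import Literature.NumberTheory.Sieve.SmoothSaddlePointUniform

/-!
# Strategist sketch (r1) — crux stmt-Parity-18777 `Theses.PolynomialKatai.PrimeMultiplierChowla`
# ("the door" of route-Parity-PolynomialKatai)

REDIRECT STRATEGIST r1 (unit `cstrat-stmt-Parity-18777-r1`, 2026-08-17). Kernel-checked POSITION
facts and the TYPED census pieces referred to by `Cruxes/PrimeMultiplierChowla/STRATEGY-CENSUS.md`.
Nothing here is a new route, a new item, or a stub of the lead's registered line `Lines/birth.lean`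
(untouched). No `sorry`.

## §1 Position: the door is consumed only through LiouvilleOpening's crux `ChowlaNatural`

The four shared decls of the route are verbatim the decls of `Theses.LiouvilleOpening`
(`*_iff` below, all `Iff.rfl`), and the route's deciding theorem factors through
`LiouvilleOpening.closes` after one application of the support item `KataiTransfer`
(stmt-Parity-18778, `PrimeMultiplierChowla → ChowlaNatural`): `closes_via_liouvilleOpening`.
So inside the cone of `closes` the door carries exactly the content of `ChowlaNatural`
(stmt-Parity-16149, the deciding crux of route-Parity-LiouvilleOpening, registered skeleton
`Cruxes/ChowlaNatural/Lines/birth.lean`), and `ghl_of_chowlaNatural` is the door-free cone.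

## §2 The door, its slice model, and the split  door ⟸ ChowlaSliceMean ∧ ZeroClassFairness

`doorTerm a Δ k e lo hi p = D(p) = ∑_{u ∈ [lo p, hi p], u ≡ e p (k)} λ(u) λ⁺(apu + Δ)` (verbatim the
crux's inner sum: `primeMultiplierChowla_iff_doorShape` is `Iff.rfl`). Substituting `m = pu`
(`λ(pu) = −λ(u)`), `−D(p)` is the ZERO CLASS `p ∣ m` of the dilated slice
`S(p) = sliceSum … p = ∑_{m ∈ [p·lo p, p·hi p], m ≡ p·e p (k)} λ(m) λ⁺(am + Δ)` (a two-point Chowla sum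
of length `≤ LX` for the bounded system `(m, am + Δ)` in a class mod `k`), whose FAIR SHARE is
`S(p)/p`. Termwise `|D(p)| ≤ |D(p) + S(p)/p| + |S(p)/p|`, so (`primeMultiplierChowla_of_sliceMean_of_fairness`,
PROVED): `ChowlaSliceMean → ZeroClassFairness → PrimeMultiplierChowla`, where
* `ChowlaSliceMean`: `∑_{p ∼ P} |S(p)|/p ≤ εX/log P` — follows from `ChowlaNatural` (each `|S(p)| ≤ εX`
  for `X ≥ X₀(L, ε)`: `m = k n + r` reparametrisation of the class, pair system `(kn + r, akn + (ar + Δ))`,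
  non-degenerate since `k ≥ 1, a ≠ 0, Δ ≠ 0`, Green–Tao size `≤ L² + L + 2` at scale `N = 2LX`, convex
  body = an interval) and Chebyshev's `π(2P) ≤ 12P/log(2P)`: it is the sibling crux 16149 read on the
  slices — PROVED in §4 (`chowlaSliceMean_of_chowlaNatural`);
* `ZeroClassFairness`: `∑_{p ∼ P} |D(p) + S(p)/p| ≤ εX/log P` — the zero classes of the prime moduli
  `p ∼ P ∈ [X^δ, X^{1/4}]` carry their fair share of the two-point sum, to RELATIVE accuracy `o(1)` on
  ℓ¹-average. The arithmetic large sieve gives only `∑_{p∼P} |D(p) + S(p)/p| ≪ X/√(log P)` for EVERY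
  bounded sequence, i.e. this piece asks a `√(log P)/ε` refinement of the large sieve on zero classes —
  a level-of-distribution statement (prime moduli of size `X^θ`, zero classes) for the two-point
  sequence `m ↦ λ(m)λ(am+Δ)`. It is the door's entire surplus over `ChowlaNatural`, and `closes` never
  uses it (§1).

HEADLINE (§4, `door_iff_chowlaNatural_and_fairness`, PROVED modulo the route's own support item
KataiTransfer = stmt-Parity-18778 taken as a hypothesis):

  `PrimeMultiplierChowla ↔ ChowlaNatural ∧ ZeroClassFairness`,

with `ChowlaNatural → ZeroClassFairness → PrimeMultiplierChowla` unconditional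
(`primeMultiplierChowla_of_chowlaNatural_of_fairness`) and `door ∧ ChowlaNatural → ZeroClassFairness`
unconditional (`zeroClassFairness_of_door_of_chowlaNatural`). The door is the sibling's deciding crux in
Kátai costume: the multiplier `p` of a completely multiplicative function is the restriction to the zero
class of `p` (`λ(pu) = −λ(u)`, tree lemma `pmc_liouville_mul_liouville_prime_mul`), and the ℓ¹-average over
the `≍ P/log P` prime multipliers is exactly Friedlander–Iwaniec's parity-breaking bilinear axiom
`∑_ℓ |∑_m β(m) a_{ℓm}|` for the sequence `a_n = λ(an + Δ)·1_slice` with `β = λ` — which for THIS sequence is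
the same two-point problem on the zero classes, not a descent.

## §3 Typed census pieces (Strengthen / Transfer), see STRATEGY-CENSUS.md

* `SignedDoor` (`|∑_p D(p)| ≤ εX/log P`): weaker than the door (`signedDoor_of_primeMultiplierChowla`,
  PROVED) and still `⇒ ChowlaNatural` by the same transfer (the pigeonholed dyadic block makes the bad
  primes' contribution `≤ 2ε'LX/log P`); by Turán–Kubilius it exceeds `ChowlaNatural` by the correlation
  of `λ(m)λ(am+Δ)` with `ω_P(m) − ∑_{p∼P} 1/p` at the `1/log P` level — the same zero-class surplus.
* `UniformLargeSlope` (S⁺, pointwise in the prime: `|D(p)| ≤ εX/P` for EVERY prime `p ∼ P`): implies the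
  door by Chebyshev (`primeMultiplierChowla_of_uniformLargeSlope`, PROVED); it is natural-density
  two-point Chowla for ONE system `(u, apu + Δ)` with a slope of size `P = X^θ`, uniformly — strictly more
  rigid and with no inductive variable (the census explains why the rigidity buys nothing).
* `PrimePairTables` (C⁺, the Kátai–Bourgain–Sarnak–Ziegler SECOND step: `λ(u)` eliminated by duality /
  Cauchy–Schwarz in `u`): `∑_{p ≠ q ∼ P} |∑_u λ⁺(apu+Δ) λ⁺(aqu+Δ)| ≤ ε X P/(log P)²` over `p,q`-dependent
  sub-intervals and classes. `PrimePairTables → PrimeMultiplierChowla` (with `ε ↦ ε²`; duality, not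
  written here) — and C⁺ is a shift-UNIFORM, sub-interval, prime-slope form of the deciding crux
  `TableChowla` (stmt-Parity-14270) of route-Parity-LiouvilleShiftedTables: the second step lands on the
  other sibling's engine crux, strengthened.
-/

set_option linter.dupNamespace false

noncomputable section

namespace Summit.Parity.GeneralizedHardyLittlewood.Cruxes.PrimeMultiplierChowla.Strategist

open scoped BigOperators Topology Manifold Classical MeasureTheory ProbabilityTheory Matrix InnerProductSpace ComplexConjugate ContinuousMap
open Filter Set Function TopologicalSpace MeasureTheory

open Summit.Parity.GeneralizedHardyLittlewood.Theses

/-! ## §1 Position -/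

/-- The route's `ChowlaNatural` is verbatim LiouvilleOpening's crux stmt-Parity-16149. -/
theorem chowlaNatural_iff :
    PolynomialKatai.ChowlaNatural ↔ LiouvilleOpening.ChowlaNatural := Iff.rfl

/-- The route's `PairLiouvilleLaw` is verbatim LiouvilleOpening's stmt-Parity-16147. -/
theorem pairLiouvilleLaw_iff :
    PolynomialKatai.PairLiouvilleLaw ↔ LiouvilleOpening.PairLiouvilleLaw := Iff.rfl

/-- The route's target `RelativePairs` is verbatim LiouvilleOpening's stmt-Parity-16146. -/
theorem relativePairs_iff :
    PolynomialKatai.RelativePairs ↔ LiouvilleOpening.RelativePairs := Iff.rfl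

/-- The route's residual `RelativePairsToGHL` is verbatim LiouvilleOpening's stmt-Parity-15917. -/
theorem relativePairsToGHL_iff :
    PolynomialKatai.RelativePairsToGHL ↔ LiouvilleOpening.RelativePairsToGHL := Iff.rfl

/-- **The door-free cone.** LiouvilleOpening's deciding theorem, read on this route's decls:
`ChowlaNatural ∧ PairLiouvilleLaw ∧ RelativePairsToGHL ⟹ GHL` — no door, no transfer. -/
theorem ghl_of_chowlaNatural (hCh : PolynomialKatai.ChowlaNatural)
    (hLaw : PolynomialKatai.PairLiouvilleLaw) (hRes : PolynomialKatai.RelativePairsToGHL) :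
    _root_.GeneralizedHardyLittlewood :=
  LiouvilleOpening.closes hLaw hCh hRes

/-- **The route's `closes` factors through LiouvilleOpening's.** With the binders of
`PolynomialKatai.closes`, the Statement follows by `LiouvilleOpening.closes` applied to `hT hP`:
the door `hP` enters only as the argument of the transfer `hT : PrimeMultiplierChowla → ChowlaNatural`
(this is literally the first line `have hCh : ChowlaNatural := hT hP` of the route's own proof, whose
remainder is LiouvilleOpening's proof verbatim). -/
theorem closes_via_liouvilleOpening (hP : PolynomialKatai.PrimeMultiplierChowla)
    (hT : PolynomialKatai.KataiTransfer) (hLaw : PolynomialKatai.PairLiouvilleLaw)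
    (hRes : PolynomialKatai.RelativePairsToGHL) : _root_.GeneralizedHardyLittlewood :=
  LiouvilleOpening.closes hLaw (hT hP) hRes

/-! ## §2 The door term, the slice model, the split -/

/-- The door's inner sum `D(p) = ∑_{u ∈ [lo p, hi p], u ≡ e p (k)} λ(u) λ⁺(apu + Δ)` (verbatim). -/
def doorTerm (a Δ : ℤ) (k : ℕ) (e lo hi : ℕ → ℕ) (p : ℕ) : ℝ :=
  ∑ u ∈ (Finset.Icc (lo p) (hi p)).filter (fun u : ℕ => u ≡ e p [MOD k]),
    ((ArithmeticFunction.liouville u : ℤ) : ℝ) *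
      ((ArithmeticFunction.liouville (Int.toNat ((a * p * u : ℤ) + Δ)) : ℤ) : ℝ)

/-- The dilated slice `S(p) = ∑_{m ∈ [p·lo p, p·hi p], m ≡ p·e p (k)} λ(m) λ⁺(am + Δ)`: the bounded
two-point sum of which `−D(p)` is the zero class `p ∣ m` (for `p ∤ k`: `m = pu`, `λ(pu) = −λ(u)`,
and `pu ≡ p·e (k) ↔ u ≡ e (k)`). -/
def sliceSum (a Δ : ℤ) (k : ℕ) (e lo hi : ℕ → ℕ) (p : ℕ) : ℝ :=
  ∑ m ∈ (Finset.Icc (p * lo p) (p * hi p)).filter (fun m : ℕ => m ≡ p * e p [MOD k]),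
    ((ArithmeticFunction.liouville m : ℤ) : ℝ) *
      ((ArithmeticFunction.liouville (Int.toNat ((a * m : ℤ) + Δ)) : ℤ) : ℝ)

/-- The door's quantifier shell over a general prime-indexed quantity `F`:
`∑_{p prime ∈ (P, 2P]} |F … p| ≤ εX/log P` under exactly the crux's side conditions. -/
def DoorShape (F : ℤ → ℤ → ℕ → (ℕ → ℕ) → (ℕ → ℕ) → (ℕ → ℕ) → ℕ → ℝ) : Prop :=
  ∀ L : ℕ, 1 ≤ L → ∀ ε : ℝ, 0 < ε → ∀ δ : ℝ, 0 < δ → ∃ X₀ : ℕ, ∀ X : ℕ, X₀ ≤ X → ∀ P : ℕ,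
    (X : ℝ) ^ δ ≤ (P : ℝ) → (P : ℝ) ≤ (X : ℝ) ^ (1 / 4 : ℝ) → ∀ a : ℤ, a ≠ 0 → |a| ≤ (L : ℤ) →
    ∀ k : ℕ, 1 ≤ k → k ≤ L → ∀ Δ : ℤ, Δ ≠ 0 → |Δ| ≤ (L : ℤ) * (X : ℤ) → ∀ e lo hi : ℕ → ℕ,
    (∀ p : ℕ, hi p * P ≤ L * X) →
      (∑ p ∈ (Finset.Ioc P (2 * P)).filter Nat.Prime, |F a Δ k e lo hi p|)
        ≤ ε * (X : ℝ) / Real.log (P : ℝ)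

/-- The crux IS `DoorShape doorTerm` (definitional unfolding, no rewriting). -/
theorem primeMultiplierChowla_iff_doorShape :
    PolynomialKatai.PrimeMultiplierChowla ↔ DoorShape doorTerm := Iff.rfl

/-- **ChowlaSliceMean** (the sibling crux read on the slices): `∑_{p∼P} |S(p)|/p ≤ εX/log P` under the
door's side conditions. Follows from `ChowlaNatural` (stmt-Parity-16149) + Chebyshev. -/
def ChowlaSliceMean : Prop :=
  DoorShape fun a Δ k e lo hi p => sliceSum a Δ k e lo hi p / (p : ℝ)

/-- **ZeroClassFairness** (the door's surplus over `ChowlaNatural`): `∑_{p∼P} |D(p) + S(p)/p| ≤ εX/log P`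
— the zero classes of the prime moduli `p ∼ P` carry their fair share of the dilated two-point sums, to
relative accuracy `o(1)` on ℓ¹-average; `√(log P)/ε` beyond the arithmetic large sieve. Never used by
`closes`. -/
def ZeroClassFairness : Prop :=
  DoorShape fun a Δ k e lo hi p => doorTerm a Δ k e lo hi p + sliceSum a Δ k e lo hi p / (p : ℝ)

/-- Shell lemma: `DoorShape (F + G) → DoorShape G → DoorShape F` (termwise `|F| ≤ |F + G| + |G|`, `ε/2 + ε/2`). -/
theorem doorShape_of_add (F G : ℤ → ℤ → ℕ → (ℕ → ℕ) → (ℕ → ℕ) → (ℕ → ℕ) → ℕ → ℝ)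
    (hFG : DoorShape fun a Δ k e lo hi p => F a Δ k e lo hi p + G a Δ k e lo hi p)
    (hG : DoorShape G) : DoorShape F := by
  intro L hL ε hε δ hδ
  obtain ⟨X₁, hX₁⟩ := hFG L hL (ε / 2) (by positivity) δ hδ
  obtain ⟨X₂, hX₂⟩ := hG L hL (ε / 2) (by positivity) δ hδ
  refine ⟨max X₁ X₂, ?_⟩
  intro X hX P hP₁ hP₂ a ha haL k hk hkL Δ hΔ hΔL e lo hi hhi
  have h1 := hX₁ X (le_of_max_le_left hX) P hP₁ hP₂ a ha haL k hk hkL Δ hΔ hΔL e lo hi hhi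
  have h2 := hX₂ X (le_of_max_le_right hX) P hP₁ hP₂ a ha haL k hk hkL Δ hΔ hΔL e lo hi hhi
  have key : ∀ x y : ℝ, |x| ≤ |x + y| + |y| := fun x y => by
    have h := abs_add_le (x + y) (-y)
    simp only [abs_neg, add_neg_cancel_right] at h
    exact h
  calc (∑ p ∈ (Finset.Ioc P (2 * P)).filter Nat.Prime, |F a Δ k e lo hi p|)
      ≤ ∑ p ∈ (Finset.Ioc P (2 * P)).filter Nat.Prime,
          (|F a Δ k e lo hi p + G a Δ k e lo hi p| + |G a Δ k e lo hi p|) :=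
        Finset.sum_le_sum fun p _ => key _ _
    _ = (∑ p ∈ (Finset.Ioc P (2 * P)).filter Nat.Prime, |F a Δ k e lo hi p + G a Δ k e lo hi p|)
          + ∑ p ∈ (Finset.Ioc P (2 * P)).filter Nat.Prime, |G a Δ k e lo hi p| :=
        Finset.sum_add_distrib
    _ ≤ ε / 2 * (X : ℝ) / Real.log (P : ℝ) + ε / 2 * (X : ℝ) / Real.log (P : ℝ) := add_le_add h1 h2
    _ = ε * (X : ℝ) / Real.log (P : ℝ) := by ring

/-- Shell lemma: `DoorShape F → DoorShape G → DoorShape (F + G)` (triangle inequality, `ε/2 + ε/2`). -/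
theorem doorShape_add (F G : ℤ → ℤ → ℕ → (ℕ → ℕ) → (ℕ → ℕ) → (ℕ → ℕ) → ℕ → ℝ)
    (hF : DoorShape F) (hG : DoorShape G) :
    DoorShape fun a Δ k e lo hi p => F a Δ k e lo hi p + G a Δ k e lo hi p := by
  intro L hL ε hε δ hδ
  obtain ⟨X₁, hX₁⟩ := hF L hL (ε / 2) (by positivity) δ hδ
  obtain ⟨X₂, hX₂⟩ := hG L hL (ε / 2) (by positivity) δ hδ
  refine ⟨max X₁ X₂, ?_⟩
  intro X hX P hP₁ hP₂ a ha haL k hk hkL Δ hΔ hΔL e lo hi hhi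
  have h1 := hX₁ X (le_of_max_le_left hX) P hP₁ hP₂ a ha haL k hk hkL Δ hΔ hΔL e lo hi hhi
  have h2 := hX₂ X (le_of_max_le_right hX) P hP₁ hP₂ a ha haL k hk hkL Δ hΔ hΔL e lo hi hhi
  calc (∑ p ∈ (Finset.Ioc P (2 * P)).filter Nat.Prime, |F a Δ k e lo hi p + G a Δ k e lo hi p|)
      ≤ ∑ p ∈ (Finset.Ioc P (2 * P)).filter Nat.Prime, (|F a Δ k e lo hi p| + |G a Δ k e lo hi p|) :=
        Finset.sum_le_sum fun p _ => abs_add_le _ _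
    _ = (∑ p ∈ (Finset.Ioc P (2 * P)).filter Nat.Prime, |F a Δ k e lo hi p|)
          + ∑ p ∈ (Finset.Ioc P (2 * P)).filter Nat.Prime, |G a Δ k e lo hi p| :=
        Finset.sum_add_distrib
    _ ≤ ε / 2 * (X : ℝ) / Real.log (P : ℝ) + ε / 2 * (X : ℝ) / Real.log (P : ℝ) := add_le_add h1 h2
    _ = ε * (X : ℝ) / Real.log (P : ℝ) := by ring

/-- Conversely the door and the slice means give zero-class fairness (triangle inequality). -/
theorem zeroClassFairness_of_door_of_sliceMean (hP : PolynomialKatai.PrimeMultiplierChowla)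
    (hMean : ChowlaSliceMean) : ZeroClassFairness :=
  doorShape_add doorTerm (fun a Δ k e lo hi p => sliceSum a Δ k e lo hi p / (p : ℝ))
    (primeMultiplierChowla_iff_doorShape.mp hP) hMean

/-- **The split (PROVED): `ChowlaSliceMean → ZeroClassFairness → PrimeMultiplierChowla`.**
The door follows from the sibling crux read on the slices plus zero-class fairness; the converse
direction `PrimeMultiplierChowla → ChowlaNatural` is the route's support item KataiTransfer. -/
theorem primeMultiplierChowla_of_sliceMean_of_fairness (hMean : ChowlaSliceMean)
    (hFair : ZeroClassFairness) : PolynomialKatai.PrimeMultiplierChowla :=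
  primeMultiplierChowla_iff_doorShape.mpr
    (doorShape_of_add doorTerm (fun a Δ k e lo hi p => sliceSum a Δ k e lo hi p / (p : ℝ)) hFair hMean)

/-! ## §3 Typed census pieces -/

/-- **SignedDoor**: the signed prime-multiplier average `|∑_{p∼P} D(p)| ≤ εX/log P`. -/
def SignedDoor : Prop :=
  ∀ L : ℕ, 1 ≤ L → ∀ ε : ℝ, 0 < ε → ∀ δ : ℝ, 0 < δ → ∃ X₀ : ℕ, ∀ X : ℕ, X₀ ≤ X → ∀ P : ℕ,
    (X : ℝ) ^ δ ≤ (P : ℝ) → (P : ℝ) ≤ (X : ℝ) ^ (1 / 4 : ℝ) → ∀ a : ℤ, a ≠ 0 → |a| ≤ (L : ℤ) →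
    ∀ k : ℕ, 1 ≤ k → k ≤ L → ∀ Δ : ℤ, Δ ≠ 0 → |Δ| ≤ (L : ℤ) * (X : ℤ) → ∀ e lo hi : ℕ → ℕ,
    (∀ p : ℕ, hi p * P ≤ L * X) →
      |∑ p ∈ (Finset.Ioc P (2 * P)).filter Nat.Prime, doorTerm a Δ k e lo hi p|
        ≤ ε * (X : ℝ) / Real.log (P : ℝ)

/-- The door implies the signed door (triangle inequality). -/
theorem signedDoor_of_primeMultiplierChowla (h : PolynomialKatai.PrimeMultiplierChowla) :
    SignedDoor := by
  intro L hL ε hε δ hδ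
  obtain ⟨X₀, hX₀⟩ := primeMultiplierChowla_iff_doorShape.mp h L hL ε hε δ hδ
  refine ⟨X₀, ?_⟩
  intro X hX P hP₁ hP₂ a ha haL k hk hkL Δ hΔ hΔL e lo hi hhi
  exact (Finset.abs_sum_le_sum_abs _ _).trans
    (hX₀ X hX P hP₁ hP₂ a ha haL k hk hkL Δ hΔ hΔL e lo hi hhi)

/-- The POINTWISE shell: for every prime `p ∈ (P, 2P]` separately, `|F … p| ≤ εX/P`, under the
door's side conditions. -/
def PointwiseShape (F : ℤ → ℤ → ℕ → (ℕ → ℕ) → (ℕ → ℕ) → (ℕ → ℕ) → ℕ → ℝ) : Prop :=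
  ∀ L : ℕ, 1 ≤ L → ∀ ε : ℝ, 0 < ε → ∀ δ : ℝ, 0 < δ → ∃ X₀ : ℕ, ∀ X : ℕ, X₀ ≤ X → ∀ P : ℕ,
    (X : ℝ) ^ δ ≤ (P : ℝ) → (P : ℝ) ≤ (X : ℝ) ^ (1 / 4 : ℝ) → ∀ a : ℤ, a ≠ 0 → |a| ≤ (L : ℤ) →
    ∀ k : ℕ, 1 ≤ k → k ≤ L → ∀ Δ : ℤ, Δ ≠ 0 → |Δ| ≤ (L : ℤ) * (X : ℤ) → ∀ e lo hi : ℕ → ℕ,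
    (∀ p : ℕ, hi p * P ≤ L * X) → ∀ p ∈ (Finset.Ioc P (2 * P)).filter Nat.Prime,
      |F a Δ k e lo hi p| ≤ ε * (X : ℝ) / (P : ℝ)

/-- Primes in `(P, 2P]` are at most `π(2P) ≤ 12 P / log (2P)` in number (Chebyshev, tree lemma
`Literature.NumberTheory.Sieve.card_primesLE_le_six_mul_div_log`). -/
theorem card_primes_Ioc_le {P : ℕ} (hP : 1 ≤ P) :
    ((((Finset.Ioc P (2 * P)).filter Nat.Prime).card : ℕ) : ℝ)
      ≤ 6 * ((((2 * P : ℕ) : ℝ)) / Real.log ((2 * P : ℕ) : ℝ)) := by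
  have hsub : (Finset.Ioc P (2 * P)).filter Nat.Prime ⊆ Nat.primesLE (2 * P) := by
    intro p hp
    rw [Finset.mem_filter, Finset.mem_Ioc] at hp
    exact Nat.mem_primesLE.mpr ⟨hp.1.2, hp.2⟩
  have hcard := Finset.card_le_card hsub
  have hcheb := Literature.NumberTheory.Sieve.card_primesLE_le_six_mul_div_log
    (show 2 ≤ 2 * P by omega)
  exact le_trans (by exact_mod_cast hcard) hcheb

/-- **Pointwise ⟹ ℓ¹-average (PROVED)**: sum a pointwise bound `εX/P` over the `≤ 12P/log(2P)` primes of
`(P, 2P]` (Chebyshev) to get `12 εX/log P`. This is the only place the prime number theory of the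
multipliers enters any of the reductions in this file. -/
theorem doorShape_of_pointwise (F : ℤ → ℤ → ℕ → (ℕ → ℕ) → (ℕ → ℕ) → (ℕ → ℕ) → ℕ → ℝ)
    (h : PointwiseShape F) : DoorShape F := by
  intro L hL ε hε δ hδ
  obtain ⟨X₀, hX₀⟩ := h L hL (ε / 12) (by positivity) δ hδ
  refine ⟨max X₀ 2, ?_⟩
  intro X hX P hP₁ hP₂ a ha haL k hk hkL Δ hΔ hΔL e lo hi hhi
  have hX₀X : X₀ ≤ X := le_of_max_le_left hX
  have hX2 : 2 ≤ X := le_of_max_le_right hX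
  have hpt := hX₀ X hX₀X P hP₁ hP₂ a ha haL k hk hkL Δ hΔ hΔL e lo hi hhi
  -- `P ≥ 2`, so `log P > 0`
  have hX1 : (1 : ℝ) < (X : ℝ) := by exact_mod_cast hX2
  have hXδ : (1 : ℝ) < (X : ℝ) ^ δ := Real.one_lt_rpow hX1 hδ
  have hP1r : (1 : ℝ) < (P : ℝ) := lt_of_lt_of_le hXδ hP₁
  have hP1 : 1 < P := by exact_mod_cast hP1r
  have hPpos : (0 : ℝ) < (P : ℝ) := by positivity
  have hlogP : 0 < Real.log (P : ℝ) := Real.log_pos hP1r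
  have hlog2P : Real.log (P : ℝ) ≤ Real.log ((2 * P : ℕ) : ℝ) := by
    apply Real.log_le_log hPpos
    push_cast
    linarith
  have hlog2Ppos : 0 < Real.log ((2 * P : ℕ) : ℝ) := lt_of_lt_of_le hlogP hlog2P
  set S := (Finset.Ioc P (2 * P)).filter Nat.Prime with hSdef
  have hsum : (∑ p ∈ S, |F a Δ k e lo hi p|) ≤ S.card • (ε / 12 * (X : ℝ) / (P : ℝ)) :=
    Finset.sum_le_card_nsmul _ _ _ hpt
  rw [nsmul_eq_mul] at hsum
  have hcard := card_primes_Ioc_le (le_of_lt hP1)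
  have hXnn : (0 : ℝ) ≤ (X : ℝ) := Nat.cast_nonneg X
  have hq : 0 ≤ ε / 12 * (X : ℝ) / (P : ℝ) := by positivity
  calc (∑ p ∈ S, |F a Δ k e lo hi p|)
      ≤ (S.card : ℝ) * (ε / 12 * (X : ℝ) / (P : ℝ)) := hsum
    _ ≤ 6 * ((((2 * P : ℕ) : ℝ)) / Real.log ((2 * P : ℕ) : ℝ)) * (ε / 12 * (X : ℝ) / (P : ℝ)) :=
        mul_le_mul_of_nonneg_right hcard hq
    _ = ε * (X : ℝ) / Real.log ((2 * P : ℕ) : ℝ) := by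
        have hP0 : (P : ℝ) ≠ 0 := ne_of_gt hPpos
        have hl0 : Real.log ((2 * P : ℕ) : ℝ) ≠ 0 := ne_of_gt hlog2Ppos
        push_cast at hl0 ⊢
        field_simp
        ring
    _ ≤ ε * (X : ℝ) / Real.log (P : ℝ) := by
        apply div_le_div_of_nonneg_left (by positivity) hlogP hlog2P

/-- **UniformLargeSlope** (S⁺): POINTWISE in the prime — for every prime `p ∈ (P, 2P]`,
`|D(p)| ≤ εX/P`: natural-density two-point Chowla for the single system `(u, apu + Δ)` whose slope
has size `P = X^θ`, uniformly in `p`, `a`, `k`, `Δ`, the class and the interval. -/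
def UniformLargeSlope : Prop :=
  PointwiseShape doorTerm

/-- **S⁺ ⟹ door (PROVED)**. -/
theorem primeMultiplierChowla_of_uniformLargeSlope (h : UniformLargeSlope) :
    PolynomialKatai.PrimeMultiplierChowla :=
  primeMultiplierChowla_iff_doorShape.mpr (doorShape_of_pointwise doorTerm h)

/-- **PrimePairTables** (C⁺ — the Kátai–Bourgain–Sarnak–Ziegler second step, `λ(u)` eliminated):
on ℓ¹-average over PAIRS of distinct primes `p, q ∈ (P, 2P]`, the `λ(u)`-free two-point sums
`∑_{u ∈ [lo, hi], u ≡ e (k)} λ⁺(apu + Δ) λ⁺(aqu + Δ)` (slopes `ap, aq` of size `P`, length `≤ LX/P`) save a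
factor `ε` over the trivial bound `≍ X P/(log P)²`, uniformly in pair-dependent sub-intervals and classes and
in the shift `|Δ| ≤ LX`. By duality (Cauchy–Schwarz in `u`, expanding the square over `p, q`, diagonal
`≪ X/log P`) `PrimePairTables → PrimeMultiplierChowla` with `ε ↦ ε²` (not written here). A shift-uniform,
sub-interval, prime-slope form of `TableChowla` (stmt-Parity-14270, route-Parity-LiouvilleShiftedTables). -/
def PrimePairTables : Prop :=
  ∀ L : ℕ, 1 ≤ L → ∀ ε : ℝ, 0 < ε → ∀ δ : ℝ, 0 < δ → ∃ X₀ : ℕ, ∀ X : ℕ, X₀ ≤ X → ∀ P : ℕ,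
    (X : ℝ) ^ δ ≤ (P : ℝ) → (P : ℝ) ≤ (X : ℝ) ^ (1 / 4 : ℝ) → ∀ a : ℤ, a ≠ 0 → |a| ≤ (L : ℤ) →
    ∀ k : ℕ, 1 ≤ k → k ≤ L → ∀ Δ : ℤ, Δ ≠ 0 → |Δ| ≤ (L : ℤ) * (X : ℤ) → ∀ e lo hi : ℕ → ℕ → ℕ,
    (∀ p q : ℕ, hi p q * P ≤ L * X) →
      (∑ p ∈ (Finset.Ioc P (2 * P)).filter Nat.Prime,
        ∑ q ∈ ((Finset.Ioc P (2 * P)).filter Nat.Prime).erase p,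
          |∑ u ∈ (Finset.Icc (lo p q) (hi p q)).filter (fun u : ℕ => u ≡ e p q [MOD k]),
            ((ArithmeticFunction.liouville (Int.toNat ((a * p * u : ℤ) + Δ)) : ℤ) : ℝ) *
              ((ArithmeticFunction.liouville (Int.toNat ((a * q * u : ℤ) + Δ)) : ℤ) : ℝ)|)
        ≤ ε * (X : ℝ) * (P : ℝ) / (Real.log (P : ℝ)) ^ 2

/-! ## §4 The sibling crux read on the slices: `ChowlaNatural → ChowlaSliceMean` (PROVED)

Each dilated slice `S(p)` is a two-point Chowla sum for the bounded, non-degenerate pair system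
`(k n + r, a k n + (a r + Δ))` (`r = p·e p mod k`: the class condition becomes the parametrisation
`m = k n + r`) over the integer points of a real interval (convex) inside `[−N, N]`, `N = 2LX`, of
Green–Tao size `≤ L² + L + 2`; so `ChowlaNatural` (the route's own copy, = stmt-Parity-16149) gives
`|S(p)| ≤ εX` for `X ≥ X₀(L, ε)` uniformly in everything, and `doorShape_of_pointwise` sums `|S(p)|/p ≤ εX/P`
over the primes. Hence the kernel-checked decomposition of the door (`primeMultiplierChowla_of_chowlaNatural_of_fairness`):

  `ChowlaNatural → ZeroClassFairness → PrimeMultiplierChowla`,   and conversely (KataiTransfer, item 18778)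
  `PrimeMultiplierChowla → ChowlaNatural`.
-/

open Literature.NumberTheory.Sieve in
/-- Sums over the filtered lattice box in dimension one are sums over an integer filter (transport along
`n ↦ n 0`). (Same statement and proof as in `Cruxes/ChowlaNatural/Lines/birth.lean`; copied, not imported,
so that this file does not depend on a line file.) -/
theorem sum_latticeBox_one (N : ℕ) (K : Set (Fin 1 → ℝ)) (F : (Fin 1 → ℤ) → ℝ) :
    ∑ n ∈ @Finset.filter (Fin 1 → ℤ) (fun n => realPoint n ∈ K) (Classical.decPred _)
        (latticeBox 1 N), F n
      = ∑ m ∈ (Finset.Icc (-(N : ℤ)) N).filter (fun m : ℤ => (fun _ : Fin 1 => (m : ℝ)) ∈ K),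
          F (fun _ => m) := by
  refine Finset.sum_nbij' (fun n => n 0) (fun m => fun _ => m) ?_ ?_ ?_ ?_ ?_
  · intro n hn
    rw [Finset.mem_filter] at hn ⊢
    obtain ⟨hbox, hK⟩ := hn
    unfold latticeBox at hbox
    rw [Fintype.mem_piFinset] at hbox
    refine ⟨hbox 0, ?_⟩
    have hrp : realPoint n = fun _ : Fin 1 => ((n 0 : ℤ) : ℝ) := by
      funext j
      rw [Subsingleton.elim j 0]
      rfl
    rw [← hrp]
    exact hK
  · intro m hm
    rw [Finset.mem_filter] at hm ⊢
    refine ⟨?_, hm.2⟩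
    unfold latticeBox
    rw [Fintype.mem_piFinset]
    exact fun _ => hm.1
  · intro n _
    funext j
    rw [Subsingleton.elim j 0]
  · intro m _
    rfl
  · intro n _
    show F n = F (fun _ => n 0)
    congr 1
    funext j
    rw [Subsingleton.elim j 0]

open Literature.NumberTheory.Sieve in
/-- Evaluation of a one-dimensional affine-linear form at a lattice point: `ψ(n) = a·n₀ + b`. -/
theorem eval_fin_one' (ψ : AffLinForm 1) (n : Fin 1 → ℤ) :
    ψ.eval n = ψ.coeff 0 * n 0 + ψ.const := by
  simp [AffLinForm.eval]

/-- **Class ↔ parametrisation.** For `0 ≤ r < k` and `B ≤ N`: summing `g` over the `m ∈ [A, B]` with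
`m % k = r` (any Finset `U` with that membership) is summing `g (k z + r)` over the integers
`z ∈ [−N, N]` with `A ≤ k z + r ≤ B` (any Finset `T` with that membership); bijection `m ↦ m / k`,
`z ↦ k z + r`. Stated membership-wise so that no `DecidablePred` instance has to match. -/
theorem sum_class_eq_sum_param {k : ℕ} (hk : 0 < k) {r : ℕ} (hr : r < k) (A B N : ℕ) (hBN : B ≤ N)
    (g : ℤ → ℝ) (U : Finset ℕ) (hU : ∀ m : ℕ, m ∈ U ↔ (A ≤ m ∧ m ≤ B) ∧ m % k = r)
    (T : Finset ℤ) (hT : ∀ z : ℤ, z ∈ T ↔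
      (-(N : ℤ) ≤ z ∧ z ≤ (N : ℤ)) ∧ ((A : ℤ) ≤ (k : ℤ) * z + r ∧ (k : ℤ) * z + r ≤ (B : ℤ))) :
    ∑ m ∈ U, g m = ∑ z ∈ T, g ((k : ℤ) * z + r) := by
  -- integers in the target filter are non-negative
  have hz0 : ∀ z : ℤ, (A : ℤ) ≤ (k : ℤ) * z + r → 0 ≤ z := by
    intro z hAz
    by_contra hneg
    have hz1 : z ≤ -1 := by omega
    have hk0 : (0 : ℤ) ≤ (k : ℤ) := Int.natCast_nonneg k
    have hmul : (k : ℤ) * z ≤ (k : ℤ) * (-1) := mul_le_mul_of_nonneg_left hz1 hk0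
    have hrk : (r : ℤ) < (k : ℤ) := by exact_mod_cast hr
    have hA0 : (0 : ℤ) ≤ (A : ℤ) := Int.natCast_nonneg A
    linarith
  have hdec : ∀ m : ℕ, m % k = r → k * (m / k) + r = m := by
    intro m hmr
    have := Nat.div_add_mod m k
    rw [hmr] at this
    exact this
  refine Finset.sum_nbij' (fun m : ℕ => ((m / k : ℕ) : ℤ)) (fun z : ℤ => k * z.toNat + r)
    ?_ ?_ ?_ ?_ ?_
  · intro m hm
    rw [hU] at hm
    obtain ⟨⟨hAm, hmB⟩, hmr⟩ := hm
    have hdecZ : (k : ℤ) * ((m / k : ℕ) : ℤ) + r = (m : ℤ) := by exact_mod_cast hdec m hmr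
    rw [hT, hdecZ]
    have hdiv_le : m / k ≤ m := Nat.div_le_self m k
    refine ⟨⟨?_, ?_⟩, ?_, ?_⟩
    · have : (0 : ℤ) ≤ ((m / k : ℕ) : ℤ) := Int.natCast_nonneg _
      omega
    · have h1 : ((m / k : ℕ) : ℤ) ≤ (m : ℤ) := by exact_mod_cast hdiv_le
      have h2 : (m : ℤ) ≤ (N : ℤ) := by exact_mod_cast hmB.trans hBN
      exact h1.trans h2
    · exact_mod_cast hAm
    · exact_mod_cast hmB
  · intro z hz
    rw [hT] at hz
    obtain ⟨-, hAz, hzB⟩ := hz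
    have hzz : ((z.toNat : ℕ) : ℤ) = z := Int.toNat_of_nonneg (hz0 z hAz)
    rw [hU]
    have hcast : ((k * z.toNat + r : ℕ) : ℤ) = (k : ℤ) * z + r := by push_cast; rw [hzz]
    refine ⟨⟨?_, ?_⟩, ?_⟩
    · have : (A : ℤ) ≤ ((k * z.toNat + r : ℕ) : ℤ) := by rw [hcast]; exact hAz
      exact_mod_cast this
    · have : ((k * z.toNat + r : ℕ) : ℤ) ≤ (B : ℤ) := by rw [hcast]; exact hzB
      exact_mod_cast this
    · rw [Nat.mul_add_mod]
      exact Nat.mod_eq_of_lt hr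
  · intro m hm
    rw [hU] at hm
    obtain ⟨-, hmr⟩ := hm
    show k * (((m / k : ℕ) : ℤ)).toNat + r = m
    rw [Int.toNat_natCast]
    exact hdec m hmr
  · intro z hz
    rw [hT] at hz
    obtain ⟨-, hAz, -⟩ := hz
    show (((k * z.toNat + r) / k : ℕ) : ℤ) = z
    rw [Nat.mul_add_div hk, Nat.div_eq_of_lt hr, add_zero]
    exact Int.toNat_of_nonneg (hz0 z hAz)
  · intro m hm
    rw [hU] at hm
    obtain ⟨-, hmr⟩ := hm
    have hdecZ : (k : ℤ) * ((m / k : ℕ) : ℤ) + r = (m : ℤ) := by exact_mod_cast hdec m hmr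
    rw [hdecZ]

/-- Membership of an integer point in the parametrising real interval
`K = [ (A − r)/k, (B − r)/k ]` (as a subset of `Fin 1 → ℝ`) is the integer condition `A ≤ k z + r ≤ B`. -/
theorem mem_paramInterval_iff {k : ℕ} (hk : 0 < k) (r A B : ℕ) (z : ℤ) :
    (fun _ : Fin 1 => (z : ℝ)) ∈ Set.Icc (fun _ : Fin 1 => ((A : ℝ) - r) / k) (fun _ => ((B : ℝ) - r) / k)
      ↔ (A : ℤ) ≤ (k : ℤ) * z + r ∧ (k : ℤ) * z + r ≤ (B : ℤ) := by
  have hkr : (0 : ℝ) < (k : ℝ) := by exact_mod_cast hk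
  simp only [Set.mem_Icc, Pi.le_def, forall_const]
  rw [div_le_iff₀ hkr, le_div_iff₀ hkr]
  constructor
  · rintro ⟨h1, h2⟩
    refine ⟨?_, ?_⟩
    · have : ((A : ℤ) : ℝ) ≤ (((k : ℤ) * z + r : ℤ) : ℝ) := by push_cast; linarith
      exact_mod_cast this
    · have : (((k : ℤ) * z + r : ℤ) : ℝ) ≤ ((B : ℤ) : ℝ) := by push_cast; linarith
      exact_mod_cast this
  · rintro ⟨h1, h2⟩
    have h1' : ((A : ℤ) : ℝ) ≤ (((k : ℤ) * z + r : ℤ) : ℝ) := by exact_mod_cast h1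
    have h2' : (((k : ℤ) * z + r : ℤ) : ℝ) ≤ ((B : ℤ) : ℝ) := by exact_mod_cast h2
    push_cast at h1' h2'
    constructor <;> linarith

/-- `λ⁺` on `ℤ` through `Int.toNat`, real-valued (the summand convention of the cruxes). -/
def lamZ (x : ℤ) : ℝ :=
  ((ArithmeticFunction.liouville (Int.toNat x) : ℤ) : ℝ)

open Literature.NumberTheory.Sieve in
/-- **The slice bound from the sibling crux.** `ChowlaNatural` gives, for `X ≥ X₀(L, ε)`, uniformly in the
door's data and in the prime `p ∈ (P, 2P]`: `|S(p)| ≤ εX`. -/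
theorem abs_sliceSum_le (hCh : PolynomialKatai.ChowlaNatural) (L : ℕ) (hL : 1 ≤ L) (ε : ℝ)
    (hε : 0 < ε) :
    ∃ X₀ : ℕ, ∀ X : ℕ, X₀ ≤ X → ∀ P : ℕ, ∀ a : ℤ, a ≠ 0 → |a| ≤ (L : ℤ) → ∀ k : ℕ, 1 ≤ k → k ≤ L →
      ∀ Δ : ℤ, Δ ≠ 0 → |Δ| ≤ (L : ℤ) * (X : ℤ) → ∀ e lo hi : ℕ → ℕ, (∀ p : ℕ, hi p * P ≤ L * X) →
      ∀ p ∈ (Finset.Ioc P (2 * P)).filter Nat.Prime, |sliceSum a Δ k e lo hi p| ≤ ε * (X : ℝ) := by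
  have hL0 : (0 : ℝ) < (L : ℝ) := by exact_mod_cast hL
  obtain ⟨N₀, hN₀⟩ := hCh (L * L + L + 2) (ε / (2 * L)) (by positivity)
  refine ⟨max N₀ L, ?_⟩
  intro X hX P a ha haL k hk hkL Δ hΔ hΔL e lo hi hhi p hp
  have hXN₀ : N₀ ≤ X := le_of_max_le_left hX
  have hXL : L ≤ X := le_of_max_le_right hX
  have hX1 : 1 ≤ X := hL.trans hXL
  rw [Finset.mem_filter, Finset.mem_Ioc] at hp
  obtain ⟨⟨hPp, hp2P⟩, hpprime⟩ := hp
  have hk0 : 0 < k := hk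
  -- the scale `N = 2LX`, the class `r`, the system `Ψ`, the interval `K`
  set N : ℕ := 2 * L * X with hNdef
  have hNN₀ : N₀ ≤ N := by
    have : X ≤ N := by rw [hNdef]; nlinarith
    exact hXN₀.trans this
  have hBN : p * hi p ≤ N := by
    calc p * hi p ≤ 2 * P * hi p := Nat.mul_le_mul_right _ hp2P
      _ = 2 * (hi p * P) := by ring
      _ ≤ 2 * (L * X) := Nat.mul_le_mul_left _ (hhi p)
      _ = N := by rw [hNdef]; ring
  obtain ⟨r, hrdef⟩ : ∃ r : ℕ, r = p * e p % k := ⟨_, rfl⟩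
  have hrk : r < k := by rw [hrdef]; exact Nat.mod_lt _ hk0
  set Ψ : Fin 2 → AffLinForm 1 :=
    ![⟨fun _ => (k : ℤ), (r : ℤ)⟩, ⟨fun _ => a * (k : ℤ), a * (r : ℤ) + Δ⟩] with hΨdef
  have hΨ0 : Ψ 0 = ⟨fun _ => (k : ℤ), (r : ℤ)⟩ := rfl
  have hΨ1 : Ψ 1 = ⟨fun _ => a * (k : ℤ), a * (r : ℤ) + Δ⟩ := rfl
  have hev0 : ∀ n : Fin 1 → ℤ, (Ψ 0).eval n = (k : ℤ) * n 0 + r := fun n => by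
    rw [eval_fin_one', hΨ0]
  have hev1 : ∀ n : Fin 1 → ℤ, (Ψ 1).eval n = a * (k : ℤ) * n 0 + (a * (r : ℤ) + Δ) := fun n => by
    rw [eval_fin_one', hΨ1]
  obtain ⟨K, hKdef⟩ : ∃ K : Set (Fin 1 → ℝ), K =
      Set.Icc (fun _ : Fin 1 => (((p * lo p : ℕ) : ℝ) - r) / k) (fun _ => (((p * hi p : ℕ) : ℝ) - r) / k) :=
    ⟨_, rfl⟩
  -- (i) non-degeneracy
  have hnd : IsNondegenerateSystem Ψ := by
    refine ⟨?_, ?_⟩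
    · intro i
      fin_cases i
      · show (fun _ : Fin 1 => (k : ℤ)) ≠ 0
        intro h
        have := congrFun h 0
        simp only [Pi.zero_apply, Nat.cast_eq_zero] at this
        omega
      · show (fun _ : Fin 1 => a * (k : ℤ)) ≠ 0
        intro h
        have := congrFun h 0
        simp only [Pi.zero_apply, mul_eq_zero, Nat.cast_eq_zero] at this
        rcases this with h' | h'
        · exact ha h'
        · omega
    · have main : ∀ α β : ℤ, (∀ n : Fin 1 → ℤ, α * (Ψ 0).eval n = β * (Ψ 1).eval n) →
          α = 0 ∧ β = 0 := by
        intro α β h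
        have h0 := h (fun _ => 0)
        have h1 := h (fun _ => 1)
        rw [hev0, hev1] at h0 h1
        simp only [mul_zero, zero_add, mul_one] at h0 h1
        have hkZ : (k : ℤ) ≠ 0 := by exact_mod_cast hk0.ne'
        have e1 : (α - β * a) * (k : ℤ) = 0 := by linear_combination h1 - h0
        have e2 : α = β * a := by
          rcases mul_eq_zero.mp e1 with h' | h'
          · linarith
          · exact absurd h' hkZ
        rw [e2] at h0
        have e3 : β * Δ = 0 := by linear_combination -h0
        have hβ : β = 0 := by
          rcases mul_eq_zero.mp e3 with h' | h'
          · exact h'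
          · exact absurd h' hΔ
        refine ⟨?_, hβ⟩
        rw [e2, hβ, zero_mul]
      intro i j hij α β hαβ
      fin_cases i <;> fin_cases j
      · exact absurd rfl hij
      · exact main α β hαβ
      · obtain ⟨h1, h2⟩ := main β α (fun n => (hαβ n).symm)
        exact ⟨h2, h1⟩
      · exact absurd rfl hij
  -- (ii) size `≤ L² + L + 2`
  have hXr1 : (1 : ℝ) ≤ (X : ℝ) := by exact_mod_cast hX1
  have hLr1 : (1 : ℝ) ≤ (L : ℝ) := by exact_mod_cast hL
  have hLXr : (L : ℝ) ≤ (X : ℝ) := by exact_mod_cast hXL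
  have hNr : (N : ℝ) = 2 * (L : ℝ) * (X : ℝ) := by rw [hNdef]; push_cast; ring
  have hNpos : (0 : ℝ) < (N : ℝ) := by rw [hNr]; positivity
  have hkr : (k : ℝ) ≤ (L : ℝ) := by exact_mod_cast hkL
  have hkr0 : (0 : ℝ) < (k : ℝ) := by exact_mod_cast hk0
  have hrr : (r : ℝ) ≤ (k : ℝ) := by exact_mod_cast hrk.le
  have hrr0 : (0 : ℝ) ≤ (r : ℝ) := Nat.cast_nonneg r
  have har : |(a : ℝ)| ≤ (L : ℝ) := by
    have : ((|a| : ℤ) : ℝ) ≤ ((L : ℤ) : ℝ) := by exact_mod_cast haL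
    simpa [Int.cast_abs] using this
  have hΔr : |(Δ : ℝ)| ≤ (L : ℝ) * (X : ℝ) := by
    have : ((|Δ| : ℤ) : ℝ) ≤ (((L : ℤ) * (X : ℤ) : ℤ) : ℝ) := by exact_mod_cast hΔL
    simpa [Int.cast_abs] using this
  have hsize : affLinSize Ψ (N : ℝ) ≤ ((L * L + L + 2 : ℕ) : ℝ) := by
    have t1 : |(((Ψ 0).coeff 0 : ℤ) : ℝ)| ≤ (L : ℝ) := by
      rw [hΨ0]
      simp only [Int.cast_natCast, Nat.abs_cast]
      exact hkr
    have t2 : |(((Ψ 1).coeff 0 : ℤ) : ℝ)| ≤ (L : ℝ) * (L : ℝ) := by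
      rw [hΨ1]
      simp only [Int.cast_mul, Int.cast_natCast, abs_mul, Nat.abs_cast]
      exact mul_le_mul har hkr hkr0.le (by positivity)
    have t3 : |(((Ψ 0).const : ℤ) : ℝ) / (N : ℝ)| ≤ 1 := by
      rw [hΨ0]
      simp only [Int.cast_natCast]
      rw [abs_div, Nat.abs_cast, abs_of_pos hNpos, div_le_one hNpos, hNr]
      nlinarith
    have t4 : |(((Ψ 1).const : ℤ) : ℝ) / (N : ℝ)| ≤ 1 := by
      rw [hΨ1]
      simp only [Int.cast_add, Int.cast_mul, Int.cast_natCast]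
      rw [abs_div, abs_of_pos hNpos, div_le_one hNpos, hNr]
      calc |(a : ℝ) * (r : ℝ) + (Δ : ℝ)| ≤ |(a : ℝ) * (r : ℝ)| + |(Δ : ℝ)| := abs_add_le _ _
        _ = |(a : ℝ)| * (r : ℝ) + |(Δ : ℝ)| := by rw [abs_mul, abs_of_nonneg hrr0]
        _ ≤ (L : ℝ) * (L : ℝ) + (L : ℝ) * (X : ℝ) :=
            add_le_add (mul_le_mul har (hrr.trans hkr) hrr0 (by positivity)) hΔr
        _ ≤ 2 * (L : ℝ) * (X : ℝ) := by nlinarith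
    unfold affLinSize
    simp only [Fin.sum_univ_two, Fin.sum_univ_one]
    push_cast
    linarith
  -- (iii) the interval
  have hKc : Convex ℝ K := by rw [hKdef]; exact convex_Icc _ _
  have hKN : K ⊆ realBox 1 (N : ℝ) := by
    rw [hKdef]
    unfold realBox
    refine Set.Icc_subset_Icc ?_ ?_
    · intro i
      simp only
      rw [le_div_iff₀ hkr0]
      have hA0 : (0 : ℝ) ≤ ((p * lo p : ℕ) : ℝ) := Nat.cast_nonneg _
      have hN1 : (k : ℝ) ≤ (N : ℝ) * (k : ℝ) := le_mul_of_one_le_left hkr0.le (by rw [hNr]; nlinarith)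
      have hrk' : (r : ℝ) < (k : ℝ) := by exact_mod_cast hrk
      linarith
    · intro i
      simp only
      rw [div_le_iff₀ hkr0]
      have hB : ((p * hi p : ℕ) : ℝ) ≤ (N : ℝ) := by exact_mod_cast hBN
      have hN1 : (N : ℝ) ≤ (N : ℝ) * (k : ℝ) :=
        le_mul_of_one_le_right hNpos.le (by exact_mod_cast hk0)
      linarith
  -- (iv) the two-point sum of ChowlaNatural for (Ψ, K, N) IS the slice sum
  have hmain := hN₀ N hNN₀ Ψ hnd hsize K hKc hKN
  set G : ℤ → ℝ := fun z => lamZ z * lamZ (a * z + Δ) with hGdef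
  have hident :
      (∑ n ∈ @Finset.filter (Fin 1 → ℤ) (fun n => realPoint n ∈ K) (Classical.decPred _)
          (latticeBox 1 N), ∏ i, ((ArithmeticFunction.liouville (Int.toNat ((Ψ i).eval n)) : ℤ) : ℝ))
        = sliceSum a Δ k e lo hi p := by
    have hsummand : ∀ n : Fin 1 → ℤ,
        (∏ i, ((ArithmeticFunction.liouville (Int.toNat ((Ψ i).eval n)) : ℤ) : ℝ))
          = G ((k : ℤ) * n 0 + r) := by
      intro n
      rw [Fin.prod_univ_two, hev0, hev1, hGdef]
      simp only [lamZ]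
      congr 3
      ring
    rw [Finset.sum_congr rfl (fun n _ => hsummand n), sum_latticeBox_one N K]
    dsimp only
    have hUmem : ∀ m : ℕ,
        m ∈ (Finset.Icc (p * lo p) (p * hi p)).filter (fun m : ℕ => m ≡ p * e p [MOD k]) ↔
          (p * lo p ≤ m ∧ m ≤ p * hi p) ∧ m % k = r := by
      intro m
      rw [Finset.mem_filter, Finset.mem_Icc, hrdef]
      exact Iff.rfl
    refine ((sum_class_eq_sum_param hk0 hrk (p * lo p) (p * hi p) N hBN G _ hUmem _ ?_).symm).trans ?_
    · intro z
      rw [Finset.mem_filter, Finset.mem_Icc, hKdef]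
      exact and_congr Iff.rfl (mem_paramInterval_iff hk0 r _ _ z)
    · unfold sliceSum
      refine Finset.sum_congr rfl fun m _ => ?_
      simp only [hGdef, lamZ, Int.toNat_natCast]
  rw [hident] at hmain
  calc |sliceSum a Δ k e lo hi p| ≤ ε / (2 * L) * (N : ℝ) := hmain
    _ = ε * (X : ℝ) := by rw [hNr]; field_simp

/-- **Pointwise slice means from the sibling crux**: `|S(p)|/p ≤ εX/P` for every prime `p ∈ (P, 2P]`. -/
theorem sliceMean_pointwise_of_chowlaNatural (hCh : PolynomialKatai.ChowlaNatural) :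
    PointwiseShape fun a Δ k e lo hi p => sliceSum a Δ k e lo hi p / (p : ℝ) := by
  intro L hL ε hε δ hδ
  obtain ⟨X₀, hX₀⟩ := abs_sliceSum_le hCh L hL ε hε
  refine ⟨max X₀ 2, ?_⟩
  intro X hX P hP₁ hP₂ a ha haL k hk hkL Δ hΔ hΔL e lo hi hhi p hp
  have hb := hX₀ X (le_of_max_le_left hX) P a ha haL k hk hkL Δ hΔ hΔL e lo hi hhi p hp
  have hX2 : 2 ≤ X := le_of_max_le_right hX
  have hX1 : (1 : ℝ) < (X : ℝ) := by exact_mod_cast hX2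
  have hXδ : (1 : ℝ) < (X : ℝ) ^ δ := Real.one_lt_rpow hX1 hδ
  have hP1r : (1 : ℝ) < (P : ℝ) := lt_of_lt_of_le hXδ hP₁
  have hPpos : (0 : ℝ) < (P : ℝ) := by linarith
  rw [Finset.mem_filter, Finset.mem_Ioc] at hp
  have hPp : (P : ℝ) ≤ (p : ℝ) := by exact_mod_cast hp.1.1.le
  have hppos : (0 : ℝ) < (p : ℝ) := lt_of_lt_of_le hPpos hPp
  have hXnn : (0 : ℝ) ≤ ε * (X : ℝ) := by positivity
  show |sliceSum a Δ k e lo hi p / (p : ℝ)| ≤ ε * (X : ℝ) / (P : ℝ)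
  rw [abs_div, abs_of_pos hppos, div_le_iff₀ hppos]
  calc |sliceSum a Δ k e lo hi p| ≤ ε * (X : ℝ) := hb
    _ = ε * (X : ℝ) / (P : ℝ) * (P : ℝ) := by field_simp
    _ ≤ ε * (X : ℝ) / (P : ℝ) * (p : ℝ) := by gcongr

/-- **`ChowlaNatural → ChowlaSliceMean` (PROVED).** -/
theorem chowlaSliceMean_of_chowlaNatural (hCh : PolynomialKatai.ChowlaNatural) : ChowlaSliceMean :=
  doorShape_of_pointwise _ (sliceMean_pointwise_of_chowlaNatural hCh)

/-- **THE DECOMPOSITION OF THE DOOR (PROVED): `ChowlaNatural → ZeroClassFairness → PrimeMultiplierChowla`.**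
The door is LiouvilleOpening's deciding crux (stmt-Parity-16149) plus zero-class fairness of the prime
moduli `p ∼ P` for the dilated two-point sums; with KataiTransfer (`door → ChowlaNatural`, item 18778) the
door and `ChowlaNatural ∧ ZeroClassFairness` sandwich each other, and `closes` consumes only `ChowlaNatural`. -/
theorem primeMultiplierChowla_of_chowlaNatural_of_fairness (hCh : PolynomialKatai.ChowlaNatural)
    (hFair : ZeroClassFairness) : PolynomialKatai.PrimeMultiplierChowla :=
  primeMultiplierChowla_of_sliceMean_of_fairness (chowlaSliceMean_of_chowlaNatural hCh) hFair

/-- The same with LiouvilleOpening's own decl (stmt-Parity-16149 by name). -/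
theorem primeMultiplierChowla_of_liouvilleOpening_chowlaNatural
    (hCh : LiouvilleOpening.ChowlaNatural) (hFair : ZeroClassFairness) :
    PolynomialKatai.PrimeMultiplierChowla :=
  primeMultiplierChowla_of_chowlaNatural_of_fairness (chowlaNatural_iff.mpr hCh) hFair

/-- `door ∧ ChowlaNatural → ZeroClassFairness` (PROVED). -/
theorem zeroClassFairness_of_door_of_chowlaNatural (hP : PolynomialKatai.PrimeMultiplierChowla)
    (hCh : PolynomialKatai.ChowlaNatural) : ZeroClassFairness :=
  zeroClassFairness_of_door_of_sliceMean hP (chowlaSliceMean_of_chowlaNatural hCh)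

/-- **THE COSTUME THEOREM (PROVED modulo the route's own support item KataiTransfer, stmt-Parity-18778,
typed `PrimeMultiplierChowla → ChowlaNatural`, "provable now"):**

  `PrimeMultiplierChowla ↔ ChowlaNatural ∧ ZeroClassFairness`.

The deciding crux of route-Parity-PolynomialKatai is LiouvilleOpening's deciding crux (stmt-Parity-16149)
conjoined with a zero-class equidistribution statement that `closes` never consumes. -/
theorem door_iff_chowlaNatural_and_fairness (hT : PolynomialKatai.KataiTransfer) :
    PolynomialKatai.PrimeMultiplierChowla ↔ (PolynomialKatai.ChowlaNatural ∧ ZeroClassFairness) :=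
  ⟨fun hP => ⟨hT hP, zeroClassFairness_of_door_of_chowlaNatural hP (hT hP)⟩,
    fun h => primeMultiplierChowla_of_chowlaNatural_of_fairness h.1 h.2⟩

end Summit.Parity.GeneralizedHardyLittlewood.Cruxes.PrimeMultiplierChowla.Strategist
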